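import Summits.BirchSwinnertonDyer.BirchSwinnertonDyer.Theses.CycTangentCM
import Summits.BirchSwinnertonDyer.BirchSwinnertonDyer.Theorems.SmallImageMuTransferAssembly
import HarnessLib

/-!
# Route `CycTangentCM` (rung K6 of BSD, leaf `BSDpOnClassX9`): the item `AssemblyK6`, proved by name

`AssemblyK6` (item stmt-BirchSwinnertonDyer-22636) is BY DEFINITION route `SmallImageMuTransfer`'s
`Assembly` (`MuTransfer → AnalyticMuZeroX9 → SchneiderX9RankOne → PublishedInputsX9 → BSDpOnClassX9`,
home item stmt-BirchSwinnertonDyer-19633), which the tree proves as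
`Theorems.smallImageMuTransfer_Assembly_proof` (kernel bridge
`Rank1Residual.bsdpOnClassX9_of_katoMuTransfer`). One `exact`. Nothing is asserted about any curve;
BSD is not proved by this. (cell `bsd-print-cf2`, seat `bsd-line-ctcm-p2`, gen 0; candidate by
`refuter-bsd-f2-manin-ref1-g3-0`.)
-/

-- the summit and its single problem are both named `BirchSwinnertonDyer` (registry layout D-0017)
set_option linter.dupNamespace false

set_option autoImplicit false

namespace Summit.BirchSwinnertonDyer.BirchSwinnertonDyer.Theorems

/-- **`AssemblyK6` of route `CycTangentCM` holds (KERNEL, by name):** it is route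
`SmallImageMuTransfer`'s `Assembly`, proved by `smallImageMuTransfer_Assembly_proof`.
Item stmt-BirchSwinnertonDyer-22636. [cite: Kato2004Asterisque, Thm. 17.4 (3) and 17.13 (p. 280)] -/
theorem cycTangentCM_AssemblyK6_proof :
    Summit.BirchSwinnertonDyer.BirchSwinnertonDyer.Theses.CycTangentCM.AssemblyK6 := by
  unfold Summit.BirchSwinnertonDyer.BirchSwinnertonDyer.Theses.CycTangentCM.AssemblyK6
  exact smallImageMuTransfer_Assembly_proof

end Summit.BirchSwinnertonDyer.BirchSwinnertonDyer.Theorems
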